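import Literature.NumberTheory.Deninger2022.ArithmeticCohomology
import Literature.NumberTheory.LFunctions.ZetaScrewThm17Proofs

/-!
# Deninger's full spectral axiom (2.3) with multiplicities is also arithmetic-free: `RH ↔ ∃` a polarized carrier with the exact multiplicities (motivic door, cc-4, test T0, strong form)

`Literature.NumberTheory.Deninger2022.SpectrumAxiom θ` is Deninger's axiom (2.3) for `k = ℚ`
(arXiv:2204.02714 §2): every generalized eigenspace `H^{θ∼α}` of `θ` on `H¹` is finite dimensional,
of dimension the order of vanishing of `ζ` at `α` (`zetaMultiplicity α`; `0` off the non-trivial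
zeros).  `Polarized θ B` is (2.5)+(2.7′): `B(θh,h') + B(h,θh') = B(h,h')` and `B` positive definite.
The Literature file proves `SpectrumAxiom θ → Polarized θ B → RiemannHypothesis` (Serre's argument).

Here we prove the converse on the DIAGONAL MODEL WITH MULTIPLICITIES: index set
`ι = Σ α : ℂ, Fin (zetaMultiplicity α)` (`m(α)` basis vectors of weight `α`), carrier `ι →₀ ℂ`,
`θ = diag(weight)`, `B` = standard Hermitian form.  Unconditionally `θ` satisfies `SpectrumAxiom`
(`spectrumAxiom_diag`: the generalized `α`-eigenspace is the span of the `m(α)` basis vectors of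
weight `α`, `maxGenEigenspace_diag`), and under RH `B` polarizes it; hence

  `RiemannHypothesis ↔ ∃ θ B, SpectrumAxiom θ ∧ Polarized θ B`   (`riemannHypothesis_iff_exists_spectrumAxiom_polarized`),
  `RiemannHypothesis ↔ ∃ θ B, ZerosAreEigenvalues θ ∧ Polarized θ B`  (`riemannHypothesis_iff_exists_polarized`, the weak half (2.3)⁻).

So even the complete axiom list (2.3) ∧ (2.7′) is consistent exactly if RH holds and decides nothing
by itself; as recorded in the cell's located-gap entry, all content of the programme is the
CONSTRUCTION of such a carrier from a geometry of `Spec ℤ̄` without using the zeros.  The generic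
diagonal lemmas (`diag`, `stdForm`, `mem_maxGenEigenspace_diag`) are stated for an arbitrary weight
`w : ι → ℂ`; `Re ρ = 1/2` under RH is `ZetaScrewThm17.re_eq_half_of_RH` (reused, not restated).

Honest grade: a reformulation (equivalent to RH); bookkeeping only.
References: C. Deninger, arXiv:2204.02714 §2 (2.3), (2.7); J.-P. Serre, Ann. of Math. 71 (1960).
-/

set_option linter.dupNamespace false

noncomputable section

open Complex Module Module.End
open Literature.NumberTheory.LFunctions Literature.NumberTheory.Deninger2022

namespace Summit.RiemannHypothesis.RiemannHypothesis.Theorems.MotivicDoor.DeningerSpectrumModel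

section Diagonal

variable {ι : Type} (w : ι → ℂ)

/-- The diagonal operator `diag(w)` on `ι →₀ ℂ`: multiplication by `w i` on the `i`-th coordinate. -/
def diag : End ℂ (ι →₀ ℂ) where
  toFun f := Finsupp.onFinset f.support (fun i => w i * f i) (by
    intro i hi
    rw [Finsupp.mem_support_iff]
    intro h0
    exact hi (by simp [h0]))
  map_add' f g := by
    ext i
    simp [mul_add]
  map_smul' c f := by
    ext i
    simp [mul_left_comm]

/-- `diag(w)` acts on the `i`-th coordinate by multiplication with `w i`. -/
@[simp] theorem diag_apply (f : ι →₀ ℂ) (i : ι) : diag w f i = w i * f i := rfl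

/-- `diag(w)` does not enlarge supports. -/
theorem support_diag_subset (f : ι →₀ ℂ) : (diag w f).support ⊆ f.support := by
  intro i hi
  rw [Finsupp.mem_support_iff] at hi ⊢
  intro h0
  exact hi (by simp [h0])

/-- Powers of `diag(w) - α` act coordinatewise by `(w i - α)^k`. -/
theorem diag_sub_pow_apply (α : ℂ) (k : ℕ) (f : ι →₀ ℂ) (i : ι) :
    (((diag w) - α • (1 : End ℂ (ι →₀ ℂ))) ^ k) f i = (w i - α) ^ k * f i := by
  induction k generalizing f with
  | zero => simp
  | succ k ih =>
    rw [pow_succ, Module.End.mul_apply, ih]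
    simp only [LinearMap.sub_apply, LinearMap.smul_apply, Module.End.one_apply, Finsupp.sub_apply,
      Finsupp.smul_apply, diag_apply, smul_eq_mul]
    ring

/-- The generalized `α`-eigenspace of `diag(w)` consists of the vectors supported on the fibre
`{i | w i = α}` (and coincides with the honest eigenspace). -/
theorem mem_maxGenEigenspace_diag {α : ℂ} {f : ι →₀ ℂ} :
    f ∈ (diag w).maxGenEigenspace α ↔ ∀ i ∈ f.support, w i = α := by
  rw [mem_maxGenEigenspace]
  constructor
  · rintro ⟨k, hk⟩ i hi
    have h := congr_arg (fun g : ι →₀ ℂ => g i) hk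
    simp only [diag_sub_pow_apply, Finsupp.coe_zero, Pi.zero_apply, mul_eq_zero] at h
    rcases h with h | h
    · exact sub_eq_zero.mp (pow_eq_zero_iff'.mp h).1
    · exact absurd h (Finsupp.mem_support_iff.mp hi)
  · intro h
    refine ⟨1, ?_⟩
    ext i
    rw [diag_sub_pow_apply, pow_one, Finsupp.coe_zero, Pi.zero_apply]
    by_cases hi : i ∈ f.support
    · simp [h i hi]
    · simp [Finsupp.notMem_support_iff.mp hi]

/-- The generalized `α`-eigenspace of `diag(w)` is the submodule of functions supported on the fibre. -/
theorem maxGenEigenspace_diag (α : ℂ) :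
    (diag w).maxGenEigenspace α = Finsupp.supported ℂ ℂ {i | w i = α} := by
  ext f
  rw [mem_maxGenEigenspace_diag, Finsupp.mem_supported]
  simp only [Set.subset_def, Finset.mem_coe, Set.mem_setOf_eq]

/-- If the fibre of `w` over `α` is finite, the generalized `α`-eigenspace of `diag(w)` is finite
dimensional of dimension the size of the fibre. -/
theorem finrank_maxGenEigenspace_diag (α : ℂ) [Fintype {i // w i = α}] :
    FiniteDimensional ℂ ((diag w).maxGenEigenspace α) ∧
      Module.finrank ℂ ((diag w).maxGenEigenspace α) = Fintype.card {i // w i = α} := by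
  let e : ((diag w).maxGenEigenspace α) ≃ₗ[ℂ] ({i | w i = α} →₀ ℂ) :=
    (LinearEquiv.ofEq _ _ (maxGenEigenspace_diag w α)).trans (Finsupp.supportedEquivFinsupp _)
  haveI : Fintype ({i | w i = α} : Set ι) := ‹Fintype {i // w i = α}›
  refine ⟨LinearEquiv.finiteDimensional e.symm, ?_⟩
  rw [LinearEquiv.finrank_eq e, Module.finrank_finsupp_self]
  exact Fintype.card_congr (Equiv.subtypeEquivRight (fun _ => Iff.rfl))

/-- The basis vector `single i 1` is an eigenvector of `diag(w)` for `w i`. -/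
theorem hasEigenvector_diag_single (i : ι) : (diag w).HasEigenvector (w i) (Finsupp.single i 1) := by
  classical
  refine ⟨?_, by simp⟩
  rw [mem_eigenspace_iff]
  ext j
  rw [diag_apply, Finsupp.smul_apply, smul_eq_mul]
  by_cases h : j = i
  · subst h; simp
  · have hs : Finsupp.single i (1 : ℂ) j = 0 := by
      rw [Finsupp.single_apply, if_neg (fun h' => h h'.symm)]
    rw [hs, mul_zero, mul_zero]

/-- The raw standard Hermitian pairing `Σ_i f(i) conj(g(i))` on `ι →₀ ℂ`. -/
def pair (f g : ι →₀ ℂ) : ℂ := ∑ i ∈ f.support, f i * starRingEnd ℂ (g i)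

/-- The pairing may be summed over any finite set containing the support of the first argument. -/
theorem pair_eq_sum {f : ι →₀ ℂ} (g : ι →₀ ℂ) {s : Finset ι} (hs : f.support ⊆ s) :
    pair f g = ∑ i ∈ s, f i * starRingEnd ℂ (g i) := by
  unfold pair
  refine Finset.sum_subset hs (fun i _ hi => ?_)
  have h0 : f i = 0 := Finsupp.notMem_support_iff.mp hi
  simp [h0]

/-- The standard Hermitian form on `ι →₀ ℂ`, linear in the first and conjugate-linear in the second
variable. -/
def stdForm : (ι →₀ ℂ) →ₗ[ℂ] (ι →₀ ℂ) →ₗ⋆[ℂ] ℂ :=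
  LinearMap.mk₂'ₛₗ (RingHom.id ℂ) (starRingEnd ℂ) pair
    (fun f₁ f₂ g => by
      classical
      have h1 : f₁.support ⊆ (f₁ + f₂).support ∪ f₁.support ∪ f₂.support :=
        Finset.subset_union_right.trans Finset.subset_union_left
      have h2 : f₂.support ⊆ (f₁ + f₂).support ∪ f₁.support ∪ f₂.support :=
        Finset.subset_union_right
      have h12 : (f₁ + f₂).support ⊆ (f₁ + f₂).support ∪ f₁.support ∪ f₂.support :=
        Finset.subset_union_left.trans Finset.subset_union_left
      rw [pair_eq_sum g h12, pair_eq_sum g h1, pair_eq_sum g h2, ← Finset.sum_add_distrib]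
      exact Finset.sum_congr rfl (fun i _ => by simp [add_mul]))
    (fun c f g => by
      rw [pair_eq_sum g (Finsupp.support_smul (b := c) (g := f)), pair, RingHom.id_apply,
        smul_eq_mul, Finset.mul_sum]
      exact Finset.sum_congr rfl (fun i _ => by simp [mul_assoc]))
    (fun f g₁ g₂ => by
      simp only [pair, Finsupp.add_apply, map_add, mul_add, Finset.sum_add_distrib])
    (fun c f g => by
      simp only [pair, Finsupp.smul_apply, smul_eq_mul, map_mul, Finset.mul_sum]
      exact Finset.sum_congr rfl (fun i _ => by ring))

/-- Unfolding the bundled form. -/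
@[simp] theorem stdForm_apply (f g : ι →₀ ℂ) : stdForm f g = pair f g := rfl

/-- `B(f,f) = Σ |f(i)|²`. -/
theorem stdForm_self_re (f : ι →₀ ℂ) : (stdForm f f).re = ∑ i ∈ f.support, Complex.normSq (f i) := by
  rw [stdForm_apply, pair, Complex.re_sum]
  exact Finset.sum_congr rfl (fun i _ => by rw [Complex.mul_conj, Complex.ofReal_re])

/-- The standard form is positive definite. -/
theorem posDef_stdForm : PosDef (stdForm (ι := ι)) := by
  intro f hf
  rw [stdForm_self_re]
  obtain ⟨i, hi⟩ : ∃ i, i ∈ f.support := by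
    by_contra h
    exact hf (Finsupp.support_eq_empty.mp (Finset.eq_empty_of_forall_notMem (by simpa using h)))
  exact Finset.sum_pos' (fun i _ => Complex.normSq_nonneg _)
    ⟨i, hi, Complex.normSq_pos.mpr (Finsupp.mem_support_iff.mp hi)⟩

/-- If every weight has real part `1/2`, `diag(w)` is skew for the standard form in Deninger's
sense: `B(θf,g) + B(f,θg) = B(f,g)` (`w i + conj (w i) = 1` coordinatewise). -/
theorem thetaSkew_diag (hw : ∀ i, (w i).re = 1 / 2) : ThetaSkew (diag w) stdForm := by
  intro f g
  rw [stdForm_apply, stdForm_apply, stdForm_apply, pair_eq_sum g (support_diag_subset w f), pair,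
    pair, ← Finset.sum_add_distrib]
  refine Finset.sum_congr rfl (fun i _ => ?_)
  have hsum : w i + starRingEnd ℂ (w i) = 1 := by
    apply Complex.ext
    · simp [hw i]; norm_num
    · simp
  simp only [diag_apply, map_mul]
  linear_combination (f i * starRingEnd ℂ (g i)) * hsum

end Diagonal

/-! ## The model with multiplicities -/

/-- Index set: `m(α)` basis vectors of weight `α` for every `α : ℂ` (`m = zetaMultiplicity`, so the
fibre is empty off the non-trivial zeros). -/
abbrev MIndex : Type := Σ α : ℂ, Fin (zetaMultiplicity α)

/-- The weight of a basis vector. -/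
def weight (i : MIndex) : ℂ := i.1

/-- The fibre of `weight` over `α` is in bijection with `Fin (zetaMultiplicity α)`. -/
def fibreEquiv (α : ℂ) : {i : MIndex // weight i = α} ≃ Fin (zetaMultiplicity α) where
  toFun i := Fin.cast (congrArg zetaMultiplicity i.2) i.1.2
  invFun n := ⟨⟨α, n⟩, rfl⟩
  left_inv := by
    rintro ⟨⟨a, j⟩, h⟩
    change a = α at h
    subst h
    rfl
  right_inv n := Fin.ext rfl

/-- The fibres of `weight` are finite. -/
instance fintypeFibre (α : ℂ) : Fintype {i : MIndex // weight i = α} :=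
  Fintype.ofEquiv _ (fibreEquiv α).symm

/-- The fibre of `weight` over `α` has exactly `zetaMultiplicity α` elements. -/
theorem card_fibre (α : ℂ) : Fintype.card {i : MIndex // weight i = α} = zetaMultiplicity α := by
  rw [Fintype.card_congr (fibreEquiv α), Fintype.card_fin]

/-- Every index carries a non-trivial zero as weight (its fibre `Fin (m α)` is inhabited). -/
theorem weight_mem (i : MIndex) : weight i ∈ ZetaZeros.riemannZetaNontrivialZeros := by
  by_contra h
  change i.1 ∉ ZetaZeros.riemannZetaNontrivialZeros at h
  have h0 : zetaMultiplicity i.1 = 0 := by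
    unfold zetaMultiplicity
    rw [if_neg h]
  exact Fin.elim0 (Fin.cast h0 i.2)

/-- **(2.3) holds unconditionally on the model**: the generalized eigenspaces of `diag(weight)` have
exactly the dimensions `zetaMultiplicity α`. -/
theorem spectrumAxiom_diag : SpectrumAxiom (diag weight) := by
  intro α
  obtain ⟨hfin, hrank⟩ := finrank_maxGenEigenspace_diag weight α
  exact ⟨hfin, hrank.trans (card_fibre α)⟩

/-- Under RH the multiplicity model is a polarized carrier satisfying the full axiom (2.3). -/
theorem model_of_rh (hRH : RiemannHypothesis) :
    SpectrumAxiom (diag weight) ∧ Polarized (diag weight) stdForm :=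
  ⟨spectrumAxiom_diag,
    thetaSkew_diag weight (fun i => ZetaScrewThm17.re_eq_half_of_RH hRH (weight_mem i)),
    posDef_stdForm⟩

/-- **T0, strong form.** The Riemann Hypothesis is EQUIVALENT to the existence, on the model space
`(Σ α, Fin (m α)) →₀ ℂ`, of an endomorphism satisfying Deninger's spectral axiom (2.3) with the exact
multiplicities together with a `θ`-compatible positive definite sesquilinear form ((2.5)+(2.7′)).
`←` is Serre's argument (`riemannHypothesis_of_spectrum_of_polarized`, valid for ANY carrier);
`→` is the diagonal model.  The axiom list carries no arithmetic. -/
theorem riemannHypothesis_iff_exists_spectrumAxiom_polarized :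
    RiemannHypothesis ↔
      ∃ (θ : End ℂ (MIndex →₀ ℂ)) (B : (MIndex →₀ ℂ) →ₗ[ℂ] (MIndex →₀ ℂ) →ₗ⋆[ℂ] ℂ),
        SpectrumAxiom θ ∧ Polarized θ B :=
  ⟨fun hRH => ⟨diag weight, stdForm, model_of_rh hRH⟩,
    fun ⟨_, _, h23, hP⟩ => riemannHypothesis_of_spectrum_of_polarized h23 hP⟩

/-- **T0, weak form** (what Serre's argument actually consumes). The Riemann Hypothesis is
equivalent to the existence of an endomorphism having every non-trivial zero as an eigenvalue
((2.3)⁻, `ZerosAreEigenvalues`) together with a `θ`-compatible positive definite sesquilinear form. -/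
theorem riemannHypothesis_iff_exists_polarized :
    RiemannHypothesis ↔
      ∃ (θ : End ℂ (MIndex →₀ ℂ)) (B : (MIndex →₀ ℂ) →ₗ[ℂ] (MIndex →₀ ℂ) →ₗ⋆[ℂ] ℂ),
        ZerosAreEigenvalues θ ∧ Polarized θ B :=
  ⟨fun hRH => ⟨diag weight, stdForm, zerosAreEigenvalues_of_spectrumAxiom spectrumAxiom_diag,
      (model_of_rh hRH).2⟩,
    fun ⟨_, _, h23, hP⟩ => riemannHypothesis_of_zerosAreEigenvalues_of_polarized h23 hP⟩

end Summit.RiemannHypothesis.RiemannHypothesis.Theorems.MotivicDoor.DeningerSpectrumModel
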